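import Summits.BirchSwinnertonDyer.BirchSwinnertonDyer.Theorems.ByReductionTypeAtTwoRankOneSigmaSqRescale
import Summits.BirchSwinnertonDyer.BirchSwinnertonDyer.Theorems.ByReductionTypeAtTwoRankOneNaiveSigmaEvalLog
import Summits.BirchSwinnertonDyer.BirchSwinnertonDyer.Theorems.ByReductionTypeAtTwoRankOneSigmaHeightFirstOrder
import HarnessLib

/-!
# Route `ByReductionTypeAtTwo`, crux `RankOneAtTwoBigImageOddLocal` (item stmt-BirchSwinnertonDyer-23715), line AN62, σ₀-LEMMA BLOCK
# (cell `bsd-f1-sign2`, planner seat `-an` g49; `--supports 23715`, helper): **the squared theta relation AT POINTS for a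
# NON-integral sigma-squared series, by rescaling the formal group** — and its instance for the naive `Σ₀` at a supersingular `2`

HONEST FRAMING (D-0036/D-0054): THEOREMS ONLY (no definition, no named fact, no `sorry`, no instance); `p`-adic analysis on the
formal group of a `ℤ`-integral Weierstrass model, NOT a statement about `BSDp`; item 23715 stays OPEN; BSD is proved for no curve.
This is step 1b («property IV of `σ`», Mazur–Stein–Tate 2006 §2.7) of the CONSTRUCTION item 50D of
`Cruxes/RankOneAtTwoBigImageOddLocal/WildPairHeightAN62.lean` (a `PAdicHeightData` at a good SUPERSINGULAR `2`, where no `2`-integral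
sigma(-squared) pair exists and the tree's `padicSigmaSqEval_theta_of_exists` is vacuous): the even constant-`0` solution `Σ₀` of
the sigma-squared equation converges only on `v₂(t) > 1` (Bernardi 1981 §1), so the tree's integral evaluation calculus
(`padicEval₂_subst`, `padicEval₂_mul`, …) is applied AFTER transporting the formal identity along `(u, v) ↦ (pu, pv)`
(`…SigmaSqRescale.lean`).

* §3 **`sigmaSq_theta_points_of_rescale`** (every `p`): for `W/ℚ` elliptic `ℤ`-integral, ANY `Σ ∈ ℚ_p⟦t⟧` satisfying the formal
  squared theta relation for `W ⊗ ℚ_p` with `Σ(pt) ∈ ℤ_p⟦t⟧`, and `P, Q ∈ E(ℚ)` with `‖x‖_p > 1` and `‖z‖_p < p⁻¹`: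
  `Σ(z(P+Q))·Σ(z(P−Q)) = (x(Q) − x(P))²·Σ(z(P))²·Σ(z(Q))²`.
* §4 **`sigmaSqZero_theta_points_two`** — the instance `p = 2`, `a₁ = 0`, `Σ = Σ₀` (`[t⁰] = [t¹] = [t³] = 0`, `[t²] = 1`,
  `SatisfiesSigmaSqODE Σ₀ 0`), points of level `≥ 2` (`‖x‖₂ ≥ 16`); integrality of `Σ₀(2t)` (`isPadicInt_rescale_sigmaSq_two`) is 53D
  (`norm_coeff_sigmaShift_sigmaShift_le`).

References: [cite: MazurTate1991, Thm. 3.1 (theta relation)] [cite: BlakestadGrant2023, Thm. 15] [cite: MazurSteinTate2006, §2.7]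
[cite: Bernardi1981, §1 (domain of convergence of the naive σ)].
-/

set_option autoImplicit false

noncomputable section

open scoped Classical

open PowerSeries WeierstrassCurve Literature.NumberTheory.EllipticCurves

namespace Summit.BirchSwinnertonDyer.BirchSwinnertonDyer.Theorems

namespace NaiveSigmaLogAtTwo

/-! ### §3 The squared theta relation at points, for a series integral after rescaling by `p` -/

section Points

variable (W : WeierstrassCurve ℚ) [W.IsElliptic] [W.IsIntegral ℤ] (p : ℕ) [Fact p.Prime]

/-- **The squared theta relation at points for a NON-integral `Σ`.**  `W/ℚ` elliptic with `ℤ`-integral equation; `Σ ∈ ℚ_p⟦t⟧`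
satisfying the formal squared theta relation for `W ⊗ ℚ_p` and with `Σ(pt) ∈ ℤ_p⟦t⟧`; `P = (x₁, y₁)`, `Q = (x₂, y₂) ∈ E(ℚ)` with
`‖xᵢ‖_p > 1` and parameters `‖zᵢ‖_p < p⁻¹`.  THEN `Σ(z(P+Q))·Σ(z(P−Q)) = (x₂ − x₁)²·Σ(z(P))²·Σ(z(Q))²`.  Proof: transport the
formal identity along `(u, v) ↦ (pu, pv)` (`MvPowerSeries.rescale`), after which every factor is `p`-integral
(`Σ(p·) ∘ (F(pu,pv)/p)`, …), evaluate at `(z(P)/p, z(Q)/p)` with the tree's calculus (`padicEval₂_subst`, `formalGroupLaw_padicEval_holds`,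
`padicEval_formalXMulSq_eq`), and cancel `z(P)⁴z(Q)⁴`. [cite: BlakestadGrant2023, Thm. 15] [cite: MazurTate1991, Thm. 3.1]
[cite: Bernardi1981, §1] -/
theorem sigmaSq_theta_points_of_rescale (Sq : ℚ_[p]⟦X⟧)
    (hΘ : Sq.subst (W.baseChange ℚ_[p]).formalGroupLaw * Sq.subst (W.baseChange ℚ_[p]).formalGroupLawSub *
        (MvPowerSeries.X 0 : MvPowerSeries (Fin 2) ℚ_[p]) ^ 4 * (MvPowerSeries.X 1) ^ 4 =
      ((MvPowerSeries.X 0) ^ 2 * (W.baseChange ℚ_[p]).formalXMulSq.subst (MvPowerSeries.X 1 : MvPowerSeries (Fin 2) ℚ_[p]) -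
          (MvPowerSeries.X 1) ^ 2 *
            (W.baseChange ℚ_[p]).formalXMulSq.subst (MvPowerSeries.X 0 : MvPowerSeries (Fin 2) ℚ_[p])) ^ 2 *
        Sq.subst (MvPowerSeries.X 0 : MvPowerSeries (Fin 2) ℚ_[p]) ^ 2 *
        Sq.subst (MvPowerSeries.X 1 : MvPowerSeries (Fin 2) ℚ_[p]) ^ 2)
    (hint : IsPadicInt (rescale (p : ℚ_[p]) Sq))
    {x₁ y₁ x₂ y₂ : ℚ} (h₁ : W.toAffine.Nonsingular x₁ y₁) (h₂ : W.toAffine.Nonsingular x₂ y₂)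
    (hx₁ : 1 < ‖(x₁ : ℚ_[p])‖) (hx₂ : 1 < ‖(x₂ : ℚ_[p])‖)
    (hz₁ : ‖-(x₁ : ℚ_[p]) / y₁‖ < (p : ℝ)⁻¹) (hz₂ : ‖-(x₂ : ℚ_[p]) / y₂‖ < (p : ℝ)⁻¹) :
    padicEval Sq (W.padicParam p (.some x₁ y₁ h₁ + .some x₂ y₂ h₂)) *
        padicEval Sq (W.padicParam p (.some x₁ y₁ h₁ - .some x₂ y₂ h₂)) =
      ((x₂ : ℚ_[p]) - x₁) ^ 2 * padicEval Sq (-(x₁ : ℚ_[p]) / y₁) ^ 2 * padicEval Sq (-(x₂ : ℚ_[p]) / y₂) ^ 2 := by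
  set V := W.baseChange ℚ_[p] with hVdef
  have hFadd := formalGroupLaw_padicEval_holds p V
  -- constants
  have hp0 : (p : ℚ_[p]) ≠ 0 := by exact_mod_cast (Fact.out : p.Prime).ne_zero
  have hpn : ‖(p : ℚ_[p])‖ = (p : ℝ)⁻¹ := Padic.norm_p
  have hpn1 : ‖(p : ℚ_[p])‖ ≤ 1 := by
    rw [hpn]; exact inv_le_one_of_one_le₀ (by exact_mod_cast (Fact.out : p.Prime).one_lt.le)
  have hpR : (0 : ℝ) < p := by exact_mod_cast (Fact.out : p.Prime).pos
  -- the points over `ℚ_p`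
  set ι := W.toPadicPoint p with hιdef
  set P : W.toAffine.Point := .some x₁ y₁ h₁ with hPdef
  set Q : W.toAffine.Point := .some x₂ y₂ h₂ with hQdef
  have hιP : ι P = .some (x₁ : ℚ_[p]) (y₁ : ℚ_[p]) (nonsingular_ratCast h₁) := toPadicPoint_some h₁
  have hιQ : ι Q = .some (x₂ : ℚ_[p]) (y₂ : ℚ_[p]) (nonsingular_ratCast h₂) := toPadicPoint_some h₂
  have hιnQ : ι (-Q) = .some (x₂ : ℚ_[p]) (V.toAffine.negY (x₂ : ℚ_[p]) (y₂ : ℚ_[p]))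
      ((Affine.nonsingular_neg ..).mpr (nonsingular_ratCast h₂)) := by
    rw [map_neg, hιQ, Affine.Point.neg_some]
  have hkP : V.IsInReductionKernel (ι P) := by rw [hιP]; exact hx₁
  have hkQ : V.IsInReductionKernel (ι Q) := by rw [hιQ]; exact hx₂
  have hknQ : V.IsInReductionKernel (ι (-Q)) := by rw [hιnQ]; exact hx₂
  -- parameters
  obtain ⟨hy₁, hu0, hu1, -, -⟩ := V.param_facts (nonsingular_ratCast (p := p) h₁).1 hx₁
  obtain ⟨hy₂, hv0, hv1, -, -⟩ := V.param_facts (nonsingular_ratCast (p := p) h₂).1 hx₂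
  set u : ℚ_[p] := -(x₁ : ℚ_[p]) / y₁ with hudef
  set v : ℚ_[p] := -(x₂ : ℚ_[p]) / y₂ with hvdef
  have hzP : V.formalParameter (ι P) = u := by rw [hιP]; rfl
  have hzQ : V.formalParameter (ι Q) = v := by rw [hιQ]; rfl
  have hznQ : V.formalParameter (ι (-Q)) = padicEval V.formalNeg v := by
    rw [hιnQ, V.padicEval_formalNeg_eq (nonsingular_ratCast (p := p) h₂).1 hx₂]; rfl
  have hadd : padicEval₂ V.formalGroupLaw u v = W.padicParam p (P + Q) := by
    rw [← hzP, ← hzQ, hFadd _ _ hkP hkQ, ← map_add, formalParameter_toPadicPoint]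
  have hsub : padicEval₂ V.formalGroupLawSub u v = W.padicParam p (P - Q) := by
    unfold formalGroupLawSub
    rw [padicEval₂_substPair V.isPadicInt_formalGroupLaw (IsPadicInt.X 0) (V.isPadicInt_formalNeg.powerSeries_subst
        (IsPadicInt.X 1) (PowerSeries.HasSubst.X 1)) (MvPowerSeries.constantCoeff_X 0)
        (V.constantCoeff_formalNeg_subst_X 1) hu1 hv1,
      padicEval₂_X, padicEval₂_subst_X V.isPadicInt_formalNeg hu1 hv1]
    show padicEval₂ V.formalGroupLaw u (padicEval V.formalNeg v) = _
    rw [← hzP, ← hznQ, hFadd _ _ hkP hknQ, ← map_add, ← sub_eq_add_neg, formalParameter_toPadicPoint]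
  have hXu : padicEval V.formalXMulSq u = (x₁ : ℚ_[p]) * u ^ 2 :=
    V.padicEval_formalXMulSq_eq (nonsingular_ratCast (p := p) h₁).1 hx₁
  have hXv : padicEval V.formalXMulSq v = (x₂ : ℚ_[p]) * v ^ 2 :=
    V.padicEval_formalXMulSq_eq (nonsingular_ratCast (p := p) h₂).1 hx₂
  -- the rescaled evaluation point `(u', v') = (u/p, v/p)`
  set u' : ℚ_[p] := (p : ℚ_[p])⁻¹ * u with hu'def
  set v' : ℚ_[p] := (p : ℚ_[p])⁻¹ * v with hv'def
  have hu' : ‖u'‖ < 1 := by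
    rw [hu'def, norm_mul, norm_inv, hpn, inv_inv]
    calc (p : ℝ) * ‖u‖ < p * (p : ℝ)⁻¹ := by gcongr
      _ = 1 := mul_inv_cancel₀ hpR.ne'
  have hv' : ‖v'‖ < 1 := by
    rw [hv'def, norm_mul, norm_inv, hpn, inv_inv]
    calc (p : ℝ) * ‖v‖ < p * (p : ℝ)⁻¹ := by gcongr
      _ = 1 := mul_inv_cancel₀ hpR.ne'
  have hpu' : (p : ℚ_[p]) * u' = u := by rw [hu'def, ← mul_assoc, mul_inv_cancel₀ hp0, one_mul]
  have hpv' : (p : ℚ_[p]) * v' = v := by rw [hv'def, ← mul_assoc, mul_inv_cancel₀ hp0, one_mul]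
  -- one-variable rescaled evaluation
  have hev : ∀ (f : ℚ_[p]⟦X⟧) (w : ℚ_[p]), padicEval (rescale (p : ℚ_[p]) f) w = padicEval f ((p : ℚ_[p]) * w) := by
    intro f w
    unfold padicEval
    refine tsum_congr fun n => ?_
    rw [coeff_rescale, mul_pow]; ring
  -- transport the formal identity along `(u, v) ↦ (pu, pv)`
  set F' : MvPowerSeries (Fin 2) ℚ_[p] :=
    (p : ℚ_[p])⁻¹ • MvPowerSeries.rescale (Function.const (Fin 2) (p : ℚ_[p])) V.formalGroupLaw with hF'def
  set G' : MvPowerSeries (Fin 2) ℚ_[p] :=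
    (p : ℚ_[p])⁻¹ • MvPowerSeries.rescale (Function.const (Fin 2) (p : ℚ_[p])) V.formalGroupLawSub with hG'def
  set S' : ℚ_[p]⟦X⟧ := rescale (p : ℚ_[p]) Sq with hS'def
  set X' : ℚ_[p]⟦X⟧ := rescale (p : ℚ_[p]) V.formalXMulSq with hX'def
  have hF'0 : MvPowerSeries.constantCoeff F' = 0 := by
    rw [hF'def, MvPowerSeries.constantCoeff_smul, constantCoeff_rescale_fin_two, V.constantCoeff_formalGroupLaw, smul_zero]
  have hG'0 : MvPowerSeries.constantCoeff G' = 0 := by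
    rw [hG'def, MvPowerSeries.constantCoeff_smul, constantCoeff_rescale_fin_two, V.constantCoeff_formalGroupLawSub, smul_zero]
  have hF'i : IsPadicInt F' := isPadicInt_inv_smul_rescale V.isPadicInt_formalGroupLaw V.constantCoeff_formalGroupLaw
  have hG'i : IsPadicInt G' := isPadicInt_inv_smul_rescale V.isPadicInt_formalGroupLawSub V.constantCoeff_formalGroupLawSub
  have hS'i : IsPadicInt S' := hint
  have hX'i : IsPadicInt X' := isPadicInt_powerSeries_rescale hpn1 V.isPadicInt_formalXMulSq
  have hpX : ∀ i : Fin 2, IsPadicInt ((p : ℚ_[p]) • (MvPowerSeries.X i : MvPowerSeries (Fin 2) ℚ_[p])) := fun i => by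
    rw [MvPowerSeries.smul_eq_C_mul]; exact (IsPadicInt.C hpn1).mul (IsPadicInt.X i)
  -- the pieces after rescaling
  have eF : Sq.subst (MvPowerSeries.rescale (Function.const (Fin 2) (p : ℚ_[p])) V.formalGroupLaw) = S'.subst F' := by
    rw [hS'def, rescale_subst_eq_subst_smul _ _ (PowerSeries.HasSubst.of_constantCoeff_zero hF'0), hF'def, smul_smul,
      mul_inv_cancel₀ hp0, one_smul]
  have eG : Sq.subst (MvPowerSeries.rescale (Function.const (Fin 2) (p : ℚ_[p])) V.formalGroupLawSub) = S'.subst G' := by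
    rw [hS'def, rescale_subst_eq_subst_smul _ _ (PowerSeries.HasSubst.of_constantCoeff_zero hG'0), hG'def, smul_smul,
      mul_inv_cancel₀ hp0, one_smul]
  have eSX : ∀ i : Fin 2, Sq.subst ((p : ℚ_[p]) • (MvPowerSeries.X i : MvPowerSeries (Fin 2) ℚ_[p])) =
      S'.subst (MvPowerSeries.X i : MvPowerSeries (Fin 2) ℚ_[p]) := fun i => by
    rw [hS'def, rescale_subst_eq_subst_smul _ _ (PowerSeries.HasSubst.X i)]
  have eXX : ∀ i : Fin 2, V.formalXMulSq.subst ((p : ℚ_[p]) • (MvPowerSeries.X i : MvPowerSeries (Fin 2) ℚ_[p])) =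
      X'.subst (MvPowerSeries.X i : MvPowerSeries (Fin 2) ℚ_[p]) := fun i => by
    rw [hX'def, rescale_subst_eq_subst_smul _ _ (PowerSeries.HasSubst.X i)]
  have key0 := congrArg (MvPowerSeries.rescale (Function.const (Fin 2) (p : ℚ_[p]))) hΘ
  simp only [map_mul, map_pow, map_sub] at key0
  rw [rescale_subst _ Sq V.constantCoeff_formalGroupLaw, rescale_subst _ Sq V.constantCoeff_formalGroupLawSub,
    rescale_subst _ Sq (MvPowerSeries.constantCoeff_X 0), rescale_subst _ Sq (MvPowerSeries.constantCoeff_X 1),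
    rescale_subst _ V.formalXMulSq (MvPowerSeries.constantCoeff_X 0),
    rescale_subst _ V.formalXMulSq (MvPowerSeries.constantCoeff_X 1),
    rescale_X_fin_two, rescale_X_fin_two, eF, eG, eSX, eSX, eXX, eXX] at key0
  -- evaluate at `(u', v')`
  have key := congrArg (fun G => padicEval₂ G u' v') key0
  have hsF := hS'i.powerSeries_subst hF'i (PowerSeries.HasSubst.of_constantCoeff_zero hF'0)
  have hsG := hS'i.powerSeries_subst hG'i (PowerSeries.HasSubst.of_constantCoeff_zero hG'0)
  have hs0 := hS'i.powerSeries_subst (IsPadicInt.X (0 : Fin 2)) (PowerSeries.HasSubst.X 0)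
  have hs1 := hS'i.powerSeries_subst (IsPadicInt.X (1 : Fin 2)) (PowerSeries.HasSubst.X 1)
  have hx0 := hX'i.powerSeries_subst (IsPadicInt.X (0 : Fin 2)) (PowerSeries.HasSubst.X 0)
  have hx1' := hX'i.powerSeries_subst (IsPadicInt.X (1 : Fin 2)) (PowerSeries.HasSubst.X 1)
  have hd := ((hpX 0).pow 2 |>.mul hx1').sub ((hpX 1).pow 2 |>.mul hx0)
  have epX : ∀ i : Fin 2, padicEval₂ ((p : ℚ_[p]) • (MvPowerSeries.X i : MvPowerSeries (Fin 2) ℚ_[p])) u' v' =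
      (p : ℚ_[p]) * ![u', v'] i := fun i => by rw [padicEval₂_smul, padicEval₂_X]
  rw [padicEval₂_mul ((hsF.mul hsG).mul ((hpX 0).pow 4)) ((hpX 1).pow 4) hu' hv',
    padicEval₂_mul (hsF.mul hsG) ((hpX 0).pow 4) hu' hv', padicEval₂_mul hsF hsG hu' hv',
    padicEval₂_pow (hpX 0) hu' hv', padicEval₂_pow (hpX 1) hu' hv',
    padicEval₂_subst hS'i hF'i hF'0 hu' hv', padicEval₂_subst hS'i hG'i hG'0 hu' hv',
    padicEval₂_mul ((hd.pow 2).mul (hs0.pow 2)) (hs1.pow 2) hu' hv', padicEval₂_mul (hd.pow 2) (hs0.pow 2) hu' hv',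
    padicEval₂_pow hd hu' hv', padicEval₂_sub (((hpX 0).pow 2).mul hx1') (((hpX 1).pow 2).mul hx0) hu' hv',
    padicEval₂_mul ((hpX 0).pow 2) hx1' hu' hv', padicEval₂_mul ((hpX 1).pow 2) hx0 hu' hv',
    padicEval₂_pow (hpX 0) hu' hv', padicEval₂_pow (hpX 1) hu' hv', padicEval₂_pow hs0 hu' hv', padicEval₂_pow hs1 hu' hv',
    padicEval₂_subst_X hS'i hu' hv', padicEval₂_subst_X hS'i hu' hv', padicEval₂_subst_X hX'i hu' hv',
    padicEval₂_subst_X hX'i hu' hv', epX, epX] at key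
  simp only [Matrix.cons_val_zero, Matrix.cons_val_one] at key
  -- read the values
  have eF' : padicEval₂ F' u' v' = (p : ℚ_[p])⁻¹ * W.padicParam p (P + Q) := by
    rw [hF'def, padicEval₂_smul, padicEval₂_rescale, hpu', hpv', hadd]
  have eG' : padicEval₂ G' u' v' = (p : ℚ_[p])⁻¹ * W.padicParam p (P - Q) := by
    rw [hG'def, padicEval₂_smul, padicEval₂_rescale, hpu', hpv', hsub]
  rw [eF', eG', hS'def, hX'def, hev, hev, hev, hev, hev, hev, ← mul_assoc, mul_inv_cancel₀ hp0, one_mul, ← mul_assoc,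
    mul_inv_cancel₀ hp0, one_mul, hpu', hpv', hXu, hXv] at key
  -- cancel `u⁴ v⁴`
  have huv : u ^ 4 * v ^ 4 ≠ 0 := mul_ne_zero (pow_ne_zero 4 hu0) (pow_ne_zero 4 hv0)
  apply mul_right_cancel₀ huv
  linear_combination key

end Points

/-! ### §4 The instance: `p = 2`, `a₁ = 0`, the naive `Σ₀`, points of level `≥ 2` -/

/-- **`Σ₀(2t) ∈ ℤ₂⟦t⟧`** (53D: `‖[tⁿ](Σ₀/t²)‖ ≤ 2ⁿ`). [cite: Bernardi1981, §1] -/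
theorem isPadicInt_rescale_sigmaSq_two (W : WeierstrassCurve ℚ_[2]) (Sq L : ℚ_[2]⟦X⟧) (ha1 : W.a₁ = 0)
    (ha2 : ‖W.a₂‖ ≤ 1) (ha3 : ‖W.a₃‖ ≤ 1) (ha4 : ‖W.a₄‖ ≤ 1) (ha6 : ‖W.a₆‖ ≤ 1)
    (h0 : constantCoeff Sq = 0) (h1 : coeff 1 Sq = 0) (h2 : coeff 2 Sq = 1) (h3 : coeff 3 Sq = 0)
    (hODE : W.SatisfiesSigmaSqODE Sq 0) (hL0 : constantCoeff L = 0)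
    (hL : sigmaShift (sigmaShift Sq) * d⁄dX ℚ_[2] L = d⁄dX ℚ_[2] (sigmaShift (sigmaShift Sq))) :
    IsPadicInt (rescale (2 : ℚ_[2]) Sq) := by
  have hSb := norm_coeff_sigmaShift_sigmaShift_le W Sq L ha1 ha2 ha3 ha4 ha6 h2 h3 hODE hL0 hL
  have hSq : Sq = X * (X * sigmaShift (sigmaShift Sq)) := by
    rw [X_mul_sigmaShift (by rw [constantCoeff_sigmaShift, h1]), X_mul_sigmaShift h0]
  have h2n : ‖(2 : ℚ_[2])‖ = 2⁻¹ := by exact_mod_cast (Padic.norm_p (p := 2))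
  rw [isPadicInt_iff_coeff]
  intro n
  rw [coeff_rescale, norm_mul, norm_pow, h2n]
  rcases n with _ | _ | m
  · rw [hSq, coeff_zero_X_mul, norm_zero, mul_zero]; exact zero_le_one
  · rw [hSq, coeff_succ_X_mul, coeff_zero_X_mul, norm_zero, mul_zero]; exact zero_le_one
  · rw [hSq, coeff_succ_X_mul, coeff_succ_X_mul]
    calc (2⁻¹ : ℝ) ^ (m + 1 + 1) * ‖coeff m (sigmaShift (sigmaShift Sq))‖ ≤ (2⁻¹ : ℝ) ^ (m + 1 + 1) * 2 ^ m := by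
          gcongr; exact hSb m
      _ = ((2⁻¹ : ℝ) * 2) ^ m * (2⁻¹) ^ 2 := by rw [mul_pow]; ring
      _ ≤ 1 := by rw [inv_mul_cancel₀ (two_ne_zero : (2 : ℝ) ≠ 0), one_pow, one_mul]; norm_num

/-- **THE SQUARED THETA RELATION AT POINTS FOR THE NAIVE `Σ₀` AT `2`**: `W/ℚ` elliptic, `ℤ`-integral, `a₁ = 0`; `Σ₀ ∈ ℚ₂⟦t⟧` with
`[t⁰] = [t¹] = [t³] = 0`, `[t²] = 1`, `SatisfiesSigmaSqODE Σ₀ 0` for `W ⊗ ℚ₂`; `P, Q ∈ E(ℚ)` with `‖x‖₂ > 1` and `‖z‖₂ < ½` (the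
sigma disc at `2`, i.e. level `≥ 2`).  THEN `Σ₀(z(P+Q))·Σ₀(z(P−Q)) = (x(Q) − x(P))²·Σ₀(z(P))²·Σ₀(z(Q))²` — «property IV» for the
naive σ-function at a supersingular `2`, where no `2`-integral sigma pair exists. [cite: MazurSteinTate2006, §2.7]
[cite: MazurTate1991, Thm. 3.1] [cite: Bernardi1981, §1] -/
theorem sigmaSqZero_theta_points_two (W : WeierstrassCurve ℚ) [W.IsElliptic] [W.IsIntegral ℤ] (ha1 : W.a₁ = 0)
    (Sq : ℚ_[2]⟦X⟧) (h0 : constantCoeff Sq = 0) (h1 : coeff 1 Sq = 0) (h2 : coeff 2 Sq = 1) (h3 : coeff 3 Sq = 0)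
    (hODE : (W.baseChange ℚ_[2]).SatisfiesSigmaSqODE Sq 0)
    {x₁ y₁ x₂ y₂ : ℚ} (h₁ : W.toAffine.Nonsingular x₁ y₁) (h₂ : W.toAffine.Nonsingular x₂ y₂)
    (hx₁ : 1 < ‖(x₁ : ℚ_[2])‖) (hx₂ : 1 < ‖(x₂ : ℚ_[2])‖)
    (hz₁ : ‖-(x₁ : ℚ_[2]) / y₁‖ < 2⁻¹) (hz₂ : ‖-(x₂ : ℚ_[2]) / y₂‖ < 2⁻¹) :
    padicEval Sq (W.padicParam 2 (.some x₁ y₁ h₁ + .some x₂ y₂ h₂)) *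
        padicEval Sq (W.padicParam 2 (.some x₁ y₁ h₁ - .some x₂ y₂ h₂)) =
      ((x₂ : ℚ_[2]) - x₁) ^ 2 * padicEval Sq (-(x₁ : ℚ_[2]) / y₁) ^ 2 * padicEval Sq (-(x₂ : ℚ_[2]) / y₂) ^ 2 := by
  obtain ⟨e1, e2, e3, e4, e6⟩ := baseChange_padic_two_a W
  have ha1' : (W.baseChange ℚ_[2]).a₁ = 0 := by rw [e1, ha1, Rat.cast_zero]
  have ha2 : ‖(W.baseChange ℚ_[2]).a₂‖ ≤ 1 := by rw [e2]; exact (mem_localIntegers_iff 2 _).mp (W.a₂_mem_localIntegers 2)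
  have ha3 : ‖(W.baseChange ℚ_[2]).a₃‖ ≤ 1 := by rw [e3]; exact (mem_localIntegers_iff 2 _).mp (W.a₃_mem_localIntegers 2)
  have ha4 : ‖(W.baseChange ℚ_[2]).a₄‖ ≤ 1 := by rw [e4]; exact (mem_localIntegers_iff 2 _).mp (W.a₄_mem_localIntegers 2)
  have ha6 : ‖(W.baseChange ℚ_[2]).a₆‖ ≤ 1 := by rw [e6]; exact (mem_localIntegers_iff 2 _).mp (W.a₆_mem_localIntegers 2)
  obtain ⟨L, hL0, hL⟩ := exists_sigmaLog_two Sq h2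
  have hint := isPadicInt_rescale_sigmaSq_two (W.baseChange ℚ_[2]) Sq L ha1' ha2 ha3 ha4 ha6 h0 h1 h2 h3 hODE hL0 hL
  have hΘ := thetaSq_formal_of_coeff_three (W.baseChange ℚ_[2]) h0 h1 h2 (by rw [h3, ha1']) hODE
  exact sigmaSq_theta_points_of_rescale W 2 Sq hΘ hint h₁ h₂ hx₁ hx₂ (by exact_mod_cast hz₁) (by exact_mod_cast hz₂)

end NaiveSigmaLogAtTwo

end Summit.BirchSwinnertonDyer.BirchSwinnertonDyer.Theorems
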